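/- Free-seat work of EXTRA WIDTH SEAT `ym-line-cbag-p1-w4` (prover-ym-line-cbag-p1-w4-g2-0), route `EguchiKawaiDirectionLadder`
(ideator ym-idea-2, LINE 8), crux `TripleSmallBallMargin` (stmt-QuantumFields-27724), toward stub (b) `OffBlockDecoupling`
(see the sizing note `sizing-27724-stubB.md` attached to the item: ingredient 3 of the honest reduction (b♯)).
ROUTE-INDEPENDENT (no Theses import).  Nothing here bears on the Yang–Mills mass gap. -/
import Mathlib.MeasureTheory.Group.Convolution
import Literature.Barriers.QuantumFields.EguchiKawaiBreakdownLowerBound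
import Literature.MeasureTheory.Group.HaarLocalChart
import HarnessLib

/-!
# Route `EguchiKawaiDirectionLadder`: Haar absorption (block factorisation) for the Eguchi–Kawai a-priori measure

Every blockwise use of a within-cluster small-ball bound (stub (a) of crux `TripleSmallBallMargin`, in the
eigenbasis of the first link) factorises the Haar-distributed links as `U_μ = W_μ · V_μ` with `W_μ` Haar on `U(N)`
and `V_μ` an INDEPENDENT element of the block-diagonal subgroup (or of anything else) of any law `ν`: the product
is again Haar, so events about `U` can be bounded fibrewise in `W` by the `ν`-probability of the fibre.  This file
records exactly that, in three layers:

* §1 (general): on a group with a right-invariant s-finite measure `μ`, convolution with ANY s-finite measure `ν`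
  on the right gives back `ν(G) • μ` (`mconv_eq_smul_of_isMulRightInvariant`; `= μ` for a probability law,
  `mconv_eq_self_of_isMulRightInvariant`, i.e. `((μ ⊗ ν).map (g,h) ↦ g h) = μ`, `map_mul_prod_eq_self`); the
  mirror statement for left-invariant `μ` (`mconv_eq_smul_of_isMulLeftInvariant`); the FIBRE IDENTITY
  `μ E = ∫ ν{h | g h ∈ E} dμ(g)` (`measure_eq_lintegral_fibre`) and the FIBRE BOUND `μ E ≤ b · μ A` whenever the
  fibres over `A` have `ν`-mass `≤ b` and the fibres off `A` are `ν`-null (`measure_le_of_fibre`).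
* §2 (Eguchi–Kawai): `ekHaar d N = ⊗_μ Haar_{U(N)}` is left- and right-invariant for the pointwise group structure
  of `EKConfig d N = (Fin d → U(N))` (`isMulLeftInvariant_ekHaar`, `isMulRightInvariant_ekHaar`), simultaneous
  conjugation `U_μ ↦ V U_μ V⁻¹` preserves it (`measurePreserving_conj_ekHaar`) and leaves every plaquette trace, the
  reduced action, the open lines and the centre-symmetric region invariant (`ekPlaqTrace_conj`, `ekAction_conj`,
  `openLine_conj`, `conj_mem_ekSymRegion_iff`); and the absorption / fibre statements specialised to `ekHaar`
  (`ekHaar_mconv`, `mconv_ekHaar`, `ekHaar_eq_lintegral_fibre`, `ekHaar_le_of_fibre`).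

All proofs are Tonelli + invariance (`Literature.MeasureTheory.Group.HaarLocalChart.lintegral_measure_preimage_mul_eq`
is step (a) of the Helgason averaging lemma already in the tree).  HONEST FRAMING: measure-theoretic bookkeeping; no
small-ball estimate is proved here.  The route bears on the barrier-ledger fact `EguchiKawaiBreakdown` only.
-/

set_option autoImplicit false

noncomputable section

open MeasureTheory MeasureTheory.Measure Set
open scoped ENNReal Matrix
open Literature.Barriers.QuantumFields

namespace Summit.QuantumFields.YangMills.Theorems.EguchiKawaiDirectionLadder

/-! ### §1 A right-invariant measure absorbs any law on the right (and dually) -/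

section Absorb

variable {G : Type*} [Group G] [MeasurableSpace G] [MeasurableMul₂ G]
  {μ : Measure G} [SFinite μ] {ν : Measure G} [SFinite ν]

/-- **Right absorption.** For a right-invariant s-finite measure `μ` and any s-finite measure `ν` on a group,
`μ ∗ ν = ν(G) • μ`: `(μ ∗ ν)(B) = ∫ ν{h | g h ∈ B} dμ(g) = μ(B)·ν(G)` by Tonelli and right invariance. -/
theorem mconv_eq_smul_of_isMulRightInvariant [IsMulRightInvariant μ] : μ ∗ₘ ν = ν univ • μ := by
  ext B hB
  rw [Measure.smul_apply, smul_eq_mul, ← lintegral_indicator_one hB,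
    lintegral_mconv (measurable_one.indicator hB)]
  have h : ∀ x : G, ∫⁻ y, B.indicator (1 : G → ℝ≥0∞) (x * y) ∂ν = ν ((fun y => x * y) ⁻¹' B) := by
    intro x
    rw [← lintegral_indicator_one ((measurable_const_mul x) hB)]
    rfl
  simp_rw [h]
  rw [Literature.MeasureTheory.Group.HaarLocalChart.lintegral_measure_preimage_mul_eq hB, mul_comm]

/-- Right absorption of a probability law: `μ ∗ ν = μ`. -/
theorem mconv_eq_self_of_isMulRightInvariant [IsMulRightInvariant μ] [IsProbabilityMeasure ν] :
    μ ∗ₘ ν = μ := by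
  rw [mconv_eq_smul_of_isMulRightInvariant, measure_univ, one_smul]

/-- The same in product form: the image of `μ ⊗ ν` under multiplication is `μ` (right-invariant `μ`,
probability `ν`) — "a Haar element times an independent element of any law is again Haar". -/
theorem map_mul_prod_eq_self [IsMulRightInvariant μ] [IsProbabilityMeasure ν] :
    (μ.prod ν).map (fun p : G × G => p.1 * p.2) = μ :=
  mconv_eq_self_of_isMulRightInvariant

omit [SFinite ν] in
/-- **Left absorption.** For a left-invariant s-finite `μ` and any measure `ν`: `ν ∗ μ = ν(G) • μ`. -/
theorem mconv_eq_smul_of_isMulLeftInvariant [IsMulLeftInvariant μ] : ν ∗ₘ μ = ν univ • μ := by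
  ext B hB
  rw [Measure.smul_apply, smul_eq_mul, ← lintegral_indicator_one hB,
    lintegral_mconv (measurable_one.indicator hB)]
  have h : ∀ x : G, ∫⁻ y, B.indicator (1 : G → ℝ≥0∞) (x * y) ∂μ = μ B := by
    intro x
    have h1 : ∫⁻ y, B.indicator (1 : G → ℝ≥0∞) (x * y) ∂μ =
        ∫⁻ y, ((fun y => x * y) ⁻¹' B).indicator 1 y ∂μ := rfl
    rw [h1, lintegral_indicator_one ((measurable_const_mul x) hB), measure_preimage_mul]
  simp_rw [h]
  rw [lintegral_const, mul_comm]

omit [SFinite ν] in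
/-- Left absorption of a probability law: `ν ∗ μ = μ`. -/
theorem mconv_eq_self_of_isMulLeftInvariant [IsMulLeftInvariant μ] [IsProbabilityMeasure ν] :
    ν ∗ₘ μ = μ := by
  rw [mconv_eq_smul_of_isMulLeftInvariant, measure_univ, one_smul]

omit [SFinite ν] in
/-- Product form of left absorption: the image of `ν ⊗ μ` under multiplication is `μ`. -/
theorem map_mul_prod_eq_self_left [IsMulLeftInvariant μ] [IsProbabilityMeasure ν] :
    (ν.prod μ).map (fun p : G × G => p.1 * p.2) = μ :=
  mconv_eq_self_of_isMulLeftInvariant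

/-- **Fibre identity.** With a right-invariant `μ` and a probability law `ν`: `μ E = ∫ ν{h | g·h ∈ E} dμ(g)` for
every measurable `E` — the measure of an event is the average over a `μ`-distributed `g` of the `ν`-probability
that `g·h` lands in it. -/
theorem measure_eq_lintegral_fibre [IsMulRightInvariant μ] [IsProbabilityMeasure ν] {E : Set G}
    (hE : MeasurableSet E) : μ E = ∫⁻ g, ν ((fun h => g * h) ⁻¹' E) ∂μ := by
  rw [Literature.MeasureTheory.Group.HaarLocalChart.lintegral_measure_preimage_mul_eq hE, measure_univ,
    mul_one]

/-- **Fibre bound.** If every fibre `{h | g·h ∈ E}` over `g ∈ A` has `ν`-probability `≤ b` and every fibre over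
`g ∉ A` is `ν`-null (e.g. `E ⊆ A` with `A` stable under right multiplication by the support of `ν`), then
`μ E ≤ b · μ A`.  (`A` need not be measurable.) -/
theorem measure_le_of_fibre [IsMulRightInvariant μ] [IsProbabilityMeasure ν] {E A : Set G}
    (hE : MeasurableSet E) (b : ℝ≥0∞) (hfib : ∀ g ∈ A, ν ((fun h => g * h) ⁻¹' E) ≤ b)
    (hout : ∀ g ∉ A, ν ((fun h => g * h) ⁻¹' E) = 0) : μ E ≤ b * μ A := by
  rw [measure_eq_lintegral_fibre (ν := ν) hE]
  calc ∫⁻ g, ν ((fun h => g * h) ⁻¹' E) ∂μ ≤ ∫⁻ g, A.indicator (fun _ => b) g ∂μ := by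
        refine lintegral_mono fun g => ?_
        by_cases hg : g ∈ A
        · rw [indicator_of_mem hg]; exact hfib g hg
        · rw [indicator_of_notMem hg, hout g hg]
    _ ≤ b * μ A := lintegral_indicator_const_le A b

end Absorb

/-! ### §2 The Eguchi–Kawai a-priori measure: invariance, conjugation, absorption -/

section EK

variable {d N : ℕ}

/-- `haarProbability (UN N)` is right-invariant (compact groups are unimodular; tree lemma). -/
theorem isMulRightInvariant_haarUN :
    (Literature.MathematicalPhysics.QuantumFieldTheory.haarProbability (UN N)).IsMulRightInvariant := by
  haveI : (Literature.MathematicalPhysics.QuantumFieldTheory.haarProbability (UN N)).IsHaarMeasure := by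
    dsimp [Literature.MathematicalPhysics.QuantumFieldTheory.haarProbability]; infer_instance
  exact Literature.MeasureTheory.Group.HaarLocalChart.isMulRightInvariant_of_isHaarMeasure _

/-- `ekHaar d N` is left-invariant for the pointwise group structure of `EKConfig d N = (Fin d → U(N))`. -/
theorem isMulLeftInvariant_ekHaar : (ekHaar d N).IsMulLeftInvariant := by
  unfold ekHaar; infer_instance

/-- `ekHaar d N` is right-invariant for the pointwise group structure. -/
theorem isMulRightInvariant_ekHaar : (ekHaar d N).IsMulRightInvariant := by
  haveI := (isMulRightInvariant_haarUN (N := N))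
  unfold ekHaar; infer_instance

/-- Simultaneous conjugation of all links by a fixed `V ∈ U(N)` preserves `ekHaar d N` (left translation by
the constant configuration `V` followed by right translation by `V⁻¹`). -/
theorem measurePreserving_conj_ekHaar (V : UN N) :
    MeasurePreserving (fun U : EKConfig d N => fun μ => V * U μ * V⁻¹) (ekHaar d N) (ekHaar d N) := by
  haveI := (isMulLeftInvariant_ekHaar (d := d) (N := N))
  haveI := (isMulRightInvariant_ekHaar (d := d) (N := N))
  have h : (fun U : EKConfig d N => fun μ => V * U μ * V⁻¹) =
      (fun U : EKConfig d N => U * (fun _ => V)⁻¹) ∘ fun U : EKConfig d N => (fun _ => V) * U := by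
    ext U μ; simp [Pi.mul_apply]
  rw [h]
  exact (measurePreserving_mul_right (ekHaar d N) _).comp (measurePreserving_mul_left (ekHaar d N) _)

/-- The coerced matrix of a conjugated link. -/
theorem coe_conj_link (V W : UN N) :
    ((V * W * V⁻¹ : UN N) : Matrix (Fin N) (Fin N) ℂ) =
      (V : Matrix (Fin N) (Fin N) ℂ) * (W : Matrix (Fin N) (Fin N) ℂ) * star (V : Matrix (Fin N) (Fin N) ℂ) := by
  simp [Matrix.UnitaryGroup.inv_val]

/-- `(V A V⋆)(V B V⋆) = V (A B) V⋆` for unitary `V`. -/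
theorem conj_mul_conj (V : UN N) (A B : Matrix (Fin N) (Fin N) ℂ) :
    (V : Matrix (Fin N) (Fin N) ℂ) * A * star (V : Matrix (Fin N) (Fin N) ℂ) *
        ((V : Matrix (Fin N) (Fin N) ℂ) * B * star (V : Matrix (Fin N) (Fin N) ℂ)) =
      (V : Matrix (Fin N) (Fin N) ℂ) * (A * B) * star (V : Matrix (Fin N) (Fin N) ℂ) := by
  have hV : star (V : Matrix (Fin N) (Fin N) ℂ) * (V : Matrix (Fin N) (Fin N) ℂ) = 1 :=
    Matrix.UnitaryGroup.star_mul_self V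
  have hVX : ∀ X : Matrix (Fin N) (Fin N) ℂ,
      star (V : Matrix (Fin N) (Fin N) ℂ) * ((V : Matrix (Fin N) (Fin N) ℂ) * X) = X := fun X => by
    rw [← Matrix.mul_assoc, hV, Matrix.one_mul]
  simp only [Matrix.mul_assoc, hVX]

/-- The conjugate transpose of a conjugated matrix: `(V A V⋆)ᴴ = V Aᴴ V⋆`. -/
theorem conjTranspose_conj (V : UN N) (A : Matrix (Fin N) (Fin N) ℂ) :
    ((V : Matrix (Fin N) (Fin N) ℂ) * A * star (V : Matrix (Fin N) (Fin N) ℂ))ᴴ =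
      (V : Matrix (Fin N) (Fin N) ℂ) * Aᴴ * star (V : Matrix (Fin N) (Fin N) ℂ) := by
  rw [Matrix.star_eq_conjTranspose, Matrix.conjTranspose_mul, Matrix.conjTranspose_mul,
    Matrix.conjTranspose_conjTranspose, Matrix.mul_assoc]

/-- `tr(V M V⋆) = tr M` for unitary `V`. -/
theorem trace_conj (V : UN N) (M : Matrix (Fin N) (Fin N) ℂ) :
    Matrix.trace ((V : Matrix (Fin N) (Fin N) ℂ) * M * star (V : Matrix (Fin N) (Fin N) ℂ)) = Matrix.trace M := by
  rw [Matrix.trace_mul_cycle, Matrix.UnitaryGroup.star_mul_self, Matrix.one_mul]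

/-- **Plaquette traces are conjugation invariant**: `tr((VU_νV⁻¹)†(VU_μV⁻¹)†(VU_νV⁻¹)(VU_μV⁻¹)) = tr(U_ν†U_μ†U_νU_μ)`. -/
theorem ekPlaqTrace_conj (V : UN N) (U : EKConfig d N) (μ ν : Fin d) :
    ekPlaqTrace (fun α => V * U α * V⁻¹) μ ν = ekPlaqTrace U μ ν := by
  unfold ekPlaqTrace
  simp only [coe_conj_link, conjTranspose_conj, conj_mul_conj, trace_conj]

/-- **The reduced action is conjugation invariant**: `S_R[V U V⁻¹] = S_R[U]`. -/
theorem ekAction_conj (V : UN N) (U : EKConfig d N) :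
    ekAction (fun α => V * U α * V⁻¹) = ekAction U := by
  unfold ekAction
  simp only [ekPlaqTrace_conj]

/-- Open lines are conjugation invariant: `(1/N) tr(V U_μ V⁻¹) = (1/N) tr U_μ`. -/
theorem openLine_conj (V : UN N) (U : EKConfig d N) (μ : Fin d) :
    openLine μ (fun α => V * U α * V⁻¹) = openLine μ U := by
  unfold openLine
  rw [coe_conj_link, trace_conj]

/-- The centre-symmetric region `Sym_δ` is conjugation invariant. -/
theorem conj_mem_ekSymRegion_iff (V : UN N) (U : EKConfig d N) (δ : ℝ) :
    (fun α => V * U α * V⁻¹) ∈ ekSymRegion d N δ ↔ U ∈ ekSymRegion d N δ := by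
  simp only [ekSymRegion, Set.mem_setOf_eq, openLine_conj]

/-- The small-ball event `Sym_δ ∩ {S_R ≤ t}` is conjugation invariant (as a preimage statement). -/
theorem conj_preimage_symSmallBall (V : UN N) (δ t : ℝ) :
    (fun U : EKConfig d N => fun α => V * U α * V⁻¹) ⁻¹' (ekSymRegion d N δ ∩ {U | ekAction U ≤ t}) =
      ekSymRegion d N δ ∩ {U | ekAction U ≤ t} := by
  ext U
  simp only [Set.mem_preimage, Set.mem_inter_iff, Set.mem_setOf_eq, conj_mem_ekSymRegion_iff, ekAction_conj]

/-- **`ekHaar` absorbs any probability law on the right**: if `U ~ ekHaar d N` and `V ~ ν` is independent of `U`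
(any law `ν` on configurations, e.g. independent block-diagonal unitaries link by link), then `U·V ~ ekHaar d N`. -/
theorem ekHaar_mconv (ν : Measure (EKConfig d N)) [IsProbabilityMeasure ν] : ekHaar d N ∗ₘ ν = ekHaar d N := by
  haveI := (isMulRightInvariant_ekHaar (d := d) (N := N))
  exact mconv_eq_self_of_isMulRightInvariant

/-- `ekHaar` absorbs any probability law on the left: `V·U ~ ekHaar d N`. -/
theorem mconv_ekHaar (ν : Measure (EKConfig d N)) [IsProbabilityMeasure ν] : ν ∗ₘ ekHaar d N = ekHaar d N := by
  haveI := (isMulLeftInvariant_ekHaar (d := d) (N := N))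
  exact mconv_eq_self_of_isMulLeftInvariant

/-- Product form: the image of `ekHaar d N ⊗ ν` under linkwise multiplication `(U,V) ↦ (U_μ V_μ)_μ` is `ekHaar d N`. -/
theorem ekHaar_map_mul_prod (ν : Measure (EKConfig d N)) [IsProbabilityMeasure ν] :
    ((ekHaar d N).prod ν).map (fun p : EKConfig d N × EKConfig d N => p.1 * p.2) = ekHaar d N :=
  ekHaar_mconv ν

/-- **Fibre identity for `ekHaar`**: `ekHaar E = ∫ ν{V | U·V ∈ E} d ekHaar(U)` for every measurable event `E`
and every probability law `ν` of the (independent) right factor. -/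
theorem ekHaar_eq_lintegral_fibre (ν : Measure (EKConfig d N)) [IsProbabilityMeasure ν]
    {E : Set (EKConfig d N)} (hE : MeasurableSet E) :
    ekHaar d N E = ∫⁻ U, ν {V | U * V ∈ E} ∂ekHaar d N := by
  haveI := (isMulRightInvariant_ekHaar (d := d) (N := N))
  exact measure_eq_lintegral_fibre hE

/-- **Fibre bound for `ekHaar`**: if the `ν`-probability of the fibre `{V | U·V ∈ E}` is `≤ b` for `U ∈ A` and `0`
for `U ∉ A`, then `ekHaar E ≤ b · ekHaar A` — the shape in which a blockwise small-ball bound (over the block factor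
`V`, uniformly over the near-block-diagonal `U ∈ A`) multiplies an off-block small-ball bound `ekHaar A`. -/
theorem ekHaar_le_of_fibre (ν : Measure (EKConfig d N)) [IsProbabilityMeasure ν]
    {E A : Set (EKConfig d N)} (hE : MeasurableSet E) (b : ℝ≥0∞)
    (hfib : ∀ U ∈ A, ν {V | U * V ∈ E} ≤ b) (hout : ∀ U ∉ A, ν {V | U * V ∈ E} = 0) :
    ekHaar d N E ≤ b * ekHaar d N A := by
  haveI := (isMulRightInvariant_ekHaar (d := d) (N := N))
  exact measure_le_of_fibre hE b hfib hout

end EK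

end Summit.QuantumFields.YangMills.Theorems.EguchiKawaiDirectionLadder

end
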